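import Mathlib
import Literature.AlgebraicGeometry.Resolution.CobordantGame
import Literature.AlgebraicGeometry.Resolution.CobordantChartCoefficients
import Literature.AlgebraicGeometry.Resolution.CobordantChartPlaneSlice
import Literature.AlgebraicGeometry.Resolution.PowerSeriesRegularLocal
import Summits.ResolutionOfSingularities.ResolutionOfSingularities.Theorems.WeightedInvariantLocalWeightedDropSliceChart

/-!
# `LocalWeightedDrop`: the point blow-up of a surface germ at a near point of the `u₁`-chart, in the polygon files' format

Route `ResolutionOfSingularities/WeightedInvariant`, crux `LocalWeightedDrop` (stmt-ResolutionOfSingularities-8899), line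
`hasse-ridge-face-selection` (chain w43, [OURS · L1 W4.3]); bridge (a), step 2 of the S2/S3 attack plan.  The characteristic-polygon
files (`WeightedOrderChartLawGeneral`, `PolygonChartTransport`, `PointBlowupPolygonLaws`, …) describe the origin of the `u₁`-chart
of a point blow-up by a ring map `φ : R → R′` and regular systems of parameters `c = (y, u₁, u₂)` of `R`, `c′` of `R′` with
`c′₁ = φ u₁`, `φ y = φ u₁ · c′₀`, `φ u₂ = φ u₁ · c′₂`.  Here `R = R′ = k[[X₀, X₁, X₂]]` (regular local of dimension `3`:
`isRegularLocalRing_mvPowerSeries`, `ringKrullDim_mvPowerSeries`), the move is the game's point blow-up (all weights `1`), the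
exceptional point is `c = (c₀, c₁, c₂)` with `c₁ ≠ 0`, the successor is sliced at the slot `1`, and `φ` is the substitution
along the RESTRICTED chart `ρ = (s(c₀ + y₀), s c₁, s(c₂ + y₂))` (`s = X₀`, `y₀ = X₁`, `y₂ = X₂`) of
`…LocalWeightedDropSliceChart`.  With the TRANSLATED parameters of `R`
`c̃ = (X₀ − (c₀/c₁) X₁, X₁, X₂ − (c₂/c₁) X₁)` and `c′ = (c₁⁻¹ X₁, c₁ X₀, c₁⁻¹ X₂)` of `R′`:
* `subst_ct_one`, `subst_ct_zero`, `subst_ct_two` — the relations `h₁`, `h₀`, `h₂` of the polygon files;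
* `span_ct_eq_maximalIdeal`, `span_cprime_eq_maximalIdeal` — `c̃`, `c′` generate the maximal ideals (`hgen`, `hgen′`);
* `subst_rho_eq` — `φ f = (φ c̃₁)^a · (c₁^{-a} · Sl)`: the slice `Sl` of the `s`-saturated successor generates the weak transform.
So the near point `(c₀ : c₁ : c₂)` is the ORIGIN of the `u₁`-chart for the translated parameters `c̃`.
-/

set_option linter.dupNamespace false -- mandated namespace of this single-conjunct summit

namespace Summit.ResolutionOfSingularities.ResolutionOfSingularities.Theorems

open Literature.AlgebraicGeometry.Resolution

namespace PointChartTransport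

variable {k : Type} [Field k]

/-- The restricted chart of the point blow-up at `c`, sliced at the slot `1`, is substitutable. -/
theorem hasSubst_rho (c : Fin 3 → k) :
    MvPowerSeries.HasSubst (fun l : Fin 3 => MvPowerSeries.X (0 : Fin 3) ^ ((fun _ : Fin 3 => 1) l) *
      (MvPowerSeries.C (c l) + if l = (1 : Fin 3) then (0 : MvPowerSeries (Fin 3) k)
        else MvPowerSeries.X (Fin.predAbove (1 : Fin 3) l.succ))) :=
  MvPowerSeries.hasSubst_of_constantCoeff_zero fun l => by simp [MvPowerSeries.constantCoeff_X]

/-- `h₁`: `φ u₁ = c₁ · s` (`u₁ = c̃₁ = X₁`). -/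
theorem subst_ct_one (c : Fin 3 → k) :
    MvPowerSeries.subst (fun l : Fin 3 => MvPowerSeries.X (0 : Fin 3) ^ ((fun _ : Fin 3 => 1) l) *
      (MvPowerSeries.C (c l) + if l = (1 : Fin 3) then (0 : MvPowerSeries (Fin 3) k)
        else MvPowerSeries.X (Fin.predAbove (1 : Fin 3) l.succ))) (MvPowerSeries.X 1 : MvPowerSeries (Fin 3) k) =
      MvPowerSeries.C (c 1) * MvPowerSeries.X 0 := by
  rw [MvPowerSeries.subst_X (hasSubst_rho c)]
  simp only [if_true, pow_one, add_zero]
  ring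

/-- `h₀`: `φ (X₀ − (c₀/c₁) X₁) = φ u₁ · (c₁⁻¹ X₁)` for `c₁ ≠ 0`. -/
theorem subst_ct_zero (c : Fin 3 → k) (hc1 : c 1 ≠ 0) :
    MvPowerSeries.subst (fun l : Fin 3 => MvPowerSeries.X (0 : Fin 3) ^ ((fun _ : Fin 3 => 1) l) *
      (MvPowerSeries.C (c l) + if l = (1 : Fin 3) then (0 : MvPowerSeries (Fin 3) k)
        else MvPowerSeries.X (Fin.predAbove (1 : Fin 3) l.succ)))
        (MvPowerSeries.X 0 - MvPowerSeries.C (c 0 / c 1) * MvPowerSeries.X 1) =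
      (MvPowerSeries.C (c 1) * MvPowerSeries.X 0) * (MvPowerSeries.C (c 1)⁻¹ * MvPowerSeries.X 1) := by
  have hρ := hasSubst_rho c
  rw [MvPowerSeries.subst_sub hρ, MvPowerSeries.subst_mul hρ, MvPowerSeries.subst_C, MvPowerSeries.subst_X hρ,
    MvPowerSeries.subst_X hρ]
  have h10 : Fin.predAbove (1 : Fin 3) (0 : Fin 3).succ = 1 := by decide
  simp only [show ((0 : Fin 3) = 1) = False by decide, if_false, if_true, pow_one, add_zero, h10]
  have hc : MvPowerSeries.C (c 0 / c 1) * MvPowerSeries.C (c 1) = (MvPowerSeries.C (c 0) : MvPowerSeries (Fin 3) k) := by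
    rw [← map_mul, div_mul_cancel₀ _ hc1]
  have hc' : MvPowerSeries.C (c 1) * MvPowerSeries.C (c 1)⁻¹ = (1 : MvPowerSeries (Fin 3) k) := by
    rw [← map_mul, mul_inv_cancel₀ hc1, map_one]
  linear_combination (-(MvPowerSeries.X 0 : MvPowerSeries (Fin 3) k)) * hc -
    (MvPowerSeries.X 0 * MvPowerSeries.X 1 : MvPowerSeries (Fin 3) k) * hc'

/-- `h₂`: `φ (X₂ − (c₂/c₁) X₁) = φ u₁ · (c₁⁻¹ X₂)` for `c₁ ≠ 0`. -/
theorem subst_ct_two (c : Fin 3 → k) (hc1 : c 1 ≠ 0) :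
    MvPowerSeries.subst (fun l : Fin 3 => MvPowerSeries.X (0 : Fin 3) ^ ((fun _ : Fin 3 => 1) l) *
      (MvPowerSeries.C (c l) + if l = (1 : Fin 3) then (0 : MvPowerSeries (Fin 3) k)
        else MvPowerSeries.X (Fin.predAbove (1 : Fin 3) l.succ)))
        (MvPowerSeries.X 2 - MvPowerSeries.C (c 2 / c 1) * MvPowerSeries.X 1) =
      (MvPowerSeries.C (c 1) * MvPowerSeries.X 0) * (MvPowerSeries.C (c 1)⁻¹ * MvPowerSeries.X 2) := by
  have hρ := hasSubst_rho c
  rw [MvPowerSeries.subst_sub hρ, MvPowerSeries.subst_mul hρ, MvPowerSeries.subst_C, MvPowerSeries.subst_X hρ,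
    MvPowerSeries.subst_X hρ]
  have h12 : Fin.predAbove (1 : Fin 3) (2 : Fin 3).succ = 2 := by decide
  simp only [show ((2 : Fin 3) = 1) = False by decide, if_false, if_true, pow_one, add_zero, h12]
  have hc : MvPowerSeries.C (c 2 / c 1) * MvPowerSeries.C (c 1) = (MvPowerSeries.C (c 2) : MvPowerSeries (Fin 3) k) := by
    rw [← map_mul, div_mul_cancel₀ _ hc1]
  have hc' : MvPowerSeries.C (c 1) * MvPowerSeries.C (c 1)⁻¹ = (1 : MvPowerSeries (Fin 3) k) := by
    rw [← map_mul, mul_inv_cancel₀ hc1, map_one]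
  linear_combination (-(MvPowerSeries.X 0 : MvPowerSeries (Fin 3) k)) * hc -
    (MvPowerSeries.X 0 * MvPowerSeries.X 2 : MvPowerSeries (Fin 3) k) * hc'

/-- `hgen`: the translated parameters `c̃ = (X₀ − (c₀/c₁) X₁, X₁, X₂ − (c₂/c₁) X₁)` generate the maximal ideal of `k[[X₀,X₁,X₂]]`. -/
theorem span_ct_eq_maximalIdeal (c : Fin 3 → k) :
    Ideal.span {(MvPowerSeries.X 0 - MvPowerSeries.C (c 0 / c 1) * MvPowerSeries.X 1 : MvPowerSeries (Fin 3) k),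
      MvPowerSeries.X 1, MvPowerSeries.X 2 - MvPowerSeries.C (c 2 / c 1) * MvPowerSeries.X 1} =
      IsLocalRing.maximalIdeal (MvPowerSeries (Fin 3) k) := by
  rw [maximalIdeal_mvPowerSeries_eq_span]
  apply le_antisymm
  · rw [Ideal.span_le]
    intro x hx
    simp only [Set.mem_insert_iff, Set.mem_singleton_iff] at hx
    have hX : ∀ i : Fin 3, (MvPowerSeries.X i : MvPowerSeries (Fin 3) k) ∈
        Ideal.span (Set.range (MvPowerSeries.X : Fin 3 → MvPowerSeries (Fin 3) k)) :=
      fun i => Ideal.subset_span ⟨i, rfl⟩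
    rcases hx with rfl | rfl | rfl
    · exact Ideal.sub_mem _ (hX 0) (Ideal.mul_mem_left _ _ (hX 1))
    · exact hX 1
    · exact Ideal.sub_mem _ (hX 2) (Ideal.mul_mem_left _ _ (hX 1))
  · rw [Ideal.span_le]
    rintro _ ⟨i, rfl⟩
    have h1 : (MvPowerSeries.X 1 : MvPowerSeries (Fin 3) k) ∈ Ideal.span
        {(MvPowerSeries.X 0 - MvPowerSeries.C (c 0 / c 1) * MvPowerSeries.X 1 : MvPowerSeries (Fin 3) k),
          MvPowerSeries.X 1, MvPowerSeries.X 2 - MvPowerSeries.C (c 2 / c 1) * MvPowerSeries.X 1} :=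
      Ideal.subset_span (by simp)
    fin_cases i
    · have h0 : (MvPowerSeries.X 0 - MvPowerSeries.C (c 0 / c 1) * MvPowerSeries.X 1 : MvPowerSeries (Fin 3) k) ∈
          Ideal.span {(MvPowerSeries.X 0 - MvPowerSeries.C (c 0 / c 1) * MvPowerSeries.X 1 : MvPowerSeries (Fin 3) k),
            MvPowerSeries.X 1, MvPowerSeries.X 2 - MvPowerSeries.C (c 2 / c 1) * MvPowerSeries.X 1} :=
        Ideal.subset_span (by simp)
      have := Ideal.add_mem _ h0 (Ideal.mul_mem_left _ (MvPowerSeries.C (c 0 / c 1)) h1)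
      simpa using this
    · exact h1
    · have h2 : (MvPowerSeries.X 2 - MvPowerSeries.C (c 2 / c 1) * MvPowerSeries.X 1 : MvPowerSeries (Fin 3) k) ∈
          Ideal.span {(MvPowerSeries.X 0 - MvPowerSeries.C (c 0 / c 1) * MvPowerSeries.X 1 : MvPowerSeries (Fin 3) k),
            MvPowerSeries.X 1, MvPowerSeries.X 2 - MvPowerSeries.C (c 2 / c 1) * MvPowerSeries.X 1} :=
        Ideal.subset_span (by simp)
      have := Ideal.add_mem _ h2 (Ideal.mul_mem_left _ (MvPowerSeries.C (c 2 / c 1)) h1)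
      simpa using this

/-- `hgen′`: the parameters `c′ = (c₁⁻¹ X₁, c₁ X₀, c₁⁻¹ X₂)` of the chart ring generate its maximal ideal (`c₁ ≠ 0`). -/
theorem span_cprime_eq_maximalIdeal (c : Fin 3 → k) (hc1 : c 1 ≠ 0) :
    Ideal.span {(MvPowerSeries.C (c 1)⁻¹ * MvPowerSeries.X 1 : MvPowerSeries (Fin 3) k),
      MvPowerSeries.C (c 1) * MvPowerSeries.X 0, MvPowerSeries.C (c 1)⁻¹ * MvPowerSeries.X 2} =
      IsLocalRing.maximalIdeal (MvPowerSeries (Fin 3) k) := by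
  rw [maximalIdeal_mvPowerSeries_eq_span]
  apply le_antisymm
  · rw [Ideal.span_le]
    intro x hx
    simp only [Set.mem_insert_iff, Set.mem_singleton_iff] at hx
    have hX : ∀ i : Fin 3, (MvPowerSeries.X i : MvPowerSeries (Fin 3) k) ∈
        Ideal.span (Set.range (MvPowerSeries.X : Fin 3 → MvPowerSeries (Fin 3) k)) :=
      fun i => Ideal.subset_span ⟨i, rfl⟩
    rcases hx with rfl | rfl | rfl
    · exact Ideal.mul_mem_left _ _ (hX 1)
    · exact Ideal.mul_mem_left _ _ (hX 0)
    · exact Ideal.mul_mem_left _ _ (hX 2)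
  · rw [Ideal.span_le]
    rintro _ ⟨i, rfl⟩
    have hinv : (MvPowerSeries.C (c 1) * MvPowerSeries.C (c 1)⁻¹ : MvPowerSeries (Fin 3) k) = 1 := by
      rw [← map_mul, mul_inv_cancel₀ hc1, map_one]
    have hinv' : (MvPowerSeries.C (c 1)⁻¹ * MvPowerSeries.C (c 1) : MvPowerSeries (Fin 3) k) = 1 := by
      rw [← map_mul, inv_mul_cancel₀ hc1, map_one]
    fin_cases i
    · have h := Ideal.mul_mem_left _ (MvPowerSeries.C (c 1)⁻¹) (Ideal.subset_span (s :=
        {(MvPowerSeries.C (c 1)⁻¹ * MvPowerSeries.X 1 : MvPowerSeries (Fin 3) k),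
          MvPowerSeries.C (c 1) * MvPowerSeries.X 0, MvPowerSeries.C (c 1)⁻¹ * MvPowerSeries.X 2}) (by simp :
        (MvPowerSeries.C (c 1) * MvPowerSeries.X 0 : MvPowerSeries (Fin 3) k) ∈ _))
      rw [← mul_assoc, hinv', one_mul] at h
      exact h
    · have h := Ideal.mul_mem_left _ (MvPowerSeries.C (c 1)) (Ideal.subset_span (s :=
        {(MvPowerSeries.C (c 1)⁻¹ * MvPowerSeries.X 1 : MvPowerSeries (Fin 3) k),
          MvPowerSeries.C (c 1) * MvPowerSeries.X 0, MvPowerSeries.C (c 1)⁻¹ * MvPowerSeries.X 2}) (by simp :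
        (MvPowerSeries.C (c 1)⁻¹ * MvPowerSeries.X 1 : MvPowerSeries (Fin 3) k) ∈ _))
      rw [← mul_assoc, hinv, one_mul] at h
      exact h
    · have h := Ideal.mul_mem_left _ (MvPowerSeries.C (c 1)) (Ideal.subset_span (s :=
        {(MvPowerSeries.C (c 1)⁻¹ * MvPowerSeries.X 1 : MvPowerSeries (Fin 3) k),
          MvPowerSeries.C (c 1) * MvPowerSeries.X 0, MvPowerSeries.C (c 1)⁻¹ * MvPowerSeries.X 2}) (by simp :
        (MvPowerSeries.C (c 1)⁻¹ * MvPowerSeries.X 2 : MvPowerSeries (Fin 3) k) ∈ _))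
      rw [← mul_assoc, hinv, one_mul] at h
      exact h

/-- THE WEAK TRANSFORM IS GENERATED BY THE SLICE: if `f(s(c + y)) = sᵃ · G` (the game's point blow-up at `c`, `c₁ ≠ 0`),
then `φ f = (φ c̃₁)^a · (c₁^{-a} · Sl)` with `Sl = G|_{y₁ = 0}` and `φ` the restricted chart. -/
theorem subst_rho_eq (c : Fin 3 → k) (hc1 : c 1 ≠ 0) (f : MvPowerSeries (Fin 3) k) (a : ℕ)
    (G : MvPowerSeries (Fin 4) k)
    (hfac : MvPowerSeries.subst (CobordantChart.chart (fun _ : Fin 3 => 1) c) f = MvPowerSeries.X 0 ^ a * G) :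
    MvPowerSeries.subst (fun l : Fin 3 => MvPowerSeries.X (0 : Fin 3) ^ ((fun _ : Fin 3 => 1) l) *
      (MvPowerSeries.C (c l) + if l = (1 : Fin 3) then (0 : MvPowerSeries (Fin 3) k)
        else MvPowerSeries.X (Fin.predAbove (1 : Fin 3) l.succ))) f =
      (MvPowerSeries.C (c 1) * MvPowerSeries.X 0) ^ a *
        (MvPowerSeries.C ((c 1)⁻¹ ^ a) * MvPowerSeries.subst (fun j : Fin 4 => if j = (1 : Fin 3).succ then
          (0 : MvPowerSeries (Fin 3) k) else MvPowerSeries.X (Fin.predAbove (1 : Fin 3) j)) G) := by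
  rw [SliceChart.subst_restrictedChart (fun _ : Fin 3 => 1) c (fun l hl => absurd hl one_ne_zero) f a G hfac 1,
    mul_pow, ← map_pow]
  have hc : (MvPowerSeries.C (c 1 ^ a) * MvPowerSeries.C ((c 1)⁻¹ ^ a) : MvPowerSeries (Fin 3) k) = 1 := by
    rw [← map_mul, ← mul_pow, mul_inv_cancel₀ hc1, one_pow, map_one]
  linear_combination (-(MvPowerSeries.X 0 ^ a * MvPowerSeries.subst (fun j : Fin 4 => if j = (1 : Fin 3).succ then
    (0 : MvPowerSeries (Fin 3) k) else MvPowerSeries.X (Fin.predAbove (1 : Fin 3) j)) G)) * hc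

end PointChartTransport

end Summit.ResolutionOfSingularities.ResolutionOfSingularities.Theorems
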